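import Mathlib.Analysis.Calculus.Deriv.Prod
import Mathlib.Analysis.SpecialFunctions.Trigonometric.Angle
import Literature.Topology.FourManifolds.GaussDiagrams
import HarnessLib

/-!
# The standard unknot has the empty Gauss diagram: discharge of `unknot_hasGaussDiagram_empty`

Sibling proof file of `GaussDiagrams.lean` (D-0014: named facts `def X : Prop` are discharged as
`theorem X_holds : X`). It discharges

* `Literature.Topology.FourManifolds.unknot_hasGaussDiagram_empty_holds :
  unknot_hasGaussDiagram_empty` — **the standard unknot `t ↦ (cos t, sin t, 0, 0)` is in regular
  position with respect to the stereographic projection from the north pole and its diagram has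
  no crossing, i.e. it has the empty Gauss diagram `GaussDiagram.empty`.**

The proof is the elementary computation announced in the docstring of the fact: the unknot
`unknot = sphereInclusion 1 3` sends `circlePoint t = (cos t, sin t)` to `(cos t, sin t, 0, 0)`
(`coe_unknot_circlePoint`), whose last coordinate vanishes, so the stereographic factor
`(1 - x₃)⁻¹` is `1` and the plane curve is the unit circle `t ↦ (cos t, sin t)`
(`planeCurve_unknot`), with derivative `(-sin t, cos t) ≠ 0` (`deriv_planeCurve_unknot`,
`sin² + cos² = 1`); it is injective modulo `2π` (`Real.Angle.cos_sin_inj`), so there are no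
multiple points and all crossing conditions of `Knot.RegularProjection` are vacuous over
`Fin (2 * 0)` / `Fin 0`; the north pole `(0, 0, 0, 1)` is missed since the last coordinate of the
unknot is `0`. The resulting regular projection is built in `unknot_hasGaussDiagram_empty'`.

## References

* D. Rolfsen, *Knots and Links*, Publish or Perish (1976), §1.A (the unknot as the standard
  circle), §3.E (regular projections). [cite: Rolfsen1976, §3.E]
* R. H. Crowell, R. H. Fox, *Introduction to Knot Theory*, GTM 57 (1977), Ch. I, §3, pp. 6–7
  (regular position: only finitely many multiple points, all transverse double points; a plane
  circle has none). [cite: CrowellFox1977, Ch. I §3]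
-/

open scoped Manifold ContDiff Topology
open Function Set

noncomputable section

namespace Literature.Topology.FourManifolds

section Unknot

variable [SphereEmbedding.SmoothnessFacts]

/-- Coordinates of the standard unknot along its parametrisation:
`unknot (cos t, sin t) = (cos t, sin t, 0, 0)`. Rolfsen (1976), §1.A. [cite: Rolfsen1976, §1.A] -/
theorem coe_unknot_circlePoint (t : ℝ) (i : Fin 4) :
    ((unknot (circlePoint t) : Metric.sphere (0 : EuclideanSpace ℝ (Fin 4)) 1) :
      EuclideanSpace ℝ (Fin 4)) i = ![Real.cos t, Real.sin t, 0, 0] i := by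
  simp only [unknot, SphereEmbedding.coe_standard, coe_sphereInclusion, euclideanInclusion_apply]
  fin_cases i
  · simp [circlePoint]
  · simp [circlePoint]
  · simp
  · simp

/-- The plane curve (stereographic projection from the north pole) of the standard unknot is the
unit circle `t ↦ (cos t, sin t)`: the last coordinate of the unknot vanishes, so the
stereographic factor `(1 - x₃)⁻¹` is `1`. Rolfsen (1976), §3.E. [cite: Rolfsen1976, §3.E] -/
theorem planeCurve_unknot : unknot.planeCurve = fun t ↦ (Real.cos t, Real.sin t) := by
  funext t
  simp only [Knot.planeCurve, planarProjection, coe_unknot_circlePoint]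
  simp

/-- The height of the standard unknot over the projection plane is identically `0` (it lies in
the plane `x₂ = x₃ = 0`). [folklore] -/
theorem heightCurve_unknot : unknot.heightCurve = fun _ ↦ 0 := by
  funext t
  simp only [Knot.heightCurve, height, coe_unknot_circlePoint]
  simp

/-- The plane curve of the unknot has derivative `(-sin t, cos t)` at `t`. [folklore] -/
theorem hasDerivAt_planeCurve_unknot (t : ℝ) :
    HasDerivAt unknot.planeCurve (-Real.sin t, Real.cos t) t := by
  rw [planeCurve_unknot]
  exact (Real.hasDerivAt_cos t).prodMk (Real.hasDerivAt_sin t)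

/-- The derivative of the plane curve of the unknot is `(-sin t, cos t)`. [folklore] -/
theorem deriv_planeCurve_unknot (t : ℝ) :
    deriv unknot.planeCurve t = (-Real.sin t, Real.cos t) :=
  (hasDerivAt_planeCurve_unknot t).deriv

/-- The plane curve of the unknot is an immersion: `(-sin t, cos t) ≠ 0` since
`sin² t + cos² t = 1`. Rolfsen (1976), §3.E. [cite: Rolfsen1976, §3.E] -/
theorem deriv_planeCurve_unknot_ne_zero (t : ℝ) : deriv unknot.planeCurve t ≠ 0 := by
  rw [deriv_planeCurve_unknot]
  intro h
  have h1 : Real.sin t = 0 := by simpa using congrArg Prod.fst h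
  have h2 : Real.cos t = 0 := by simpa using congrArg Prod.snd h
  have h3 := Real.sin_sq_add_cos_sq t
  rw [h1, h2] at h3
  norm_num at h3

/-- The plane curve of the unknot has no multiple points on a period: if
`(cos s, sin s) = (cos t, sin t)` then `t = s + 2πk` for some integer `k`
(`Real.Angle.cos_sin_inj`). [folklore] -/
theorem exists_eq_add_of_planeCurve_unknot_eq {s t : ℝ}
    (h : unknot.planeCurve s = unknot.planeCurve t) : ∃ k : ℤ, t = s + k * (2 * Real.pi) := by
  rw [planeCurve_unknot] at h
  simp only [Prod.mk.injEq] at h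
  obtain ⟨hc, hs⟩ := h
  obtain ⟨k, hk⟩ := Real.Angle.angle_eq_iff_two_pi_dvd_sub.1 (Real.Angle.cos_sin_inj hc hs)
  exact ⟨-k, by push_cast; linarith⟩

/-- The standard unknot misses the north pole `(0, 0, 0, 1)`: its last coordinate is `0`.
[folklore] -/
theorem northPole_notMem_range_unknot : northPole ∉ range (unknot : Knot) := by
  rintro ⟨x, hx⟩
  have h := congrArg
    (fun p : Metric.sphere (0 : EuclideanSpace ℝ (Fin 4)) 1 ↦ (p : EuclideanSpace ℝ (Fin 4)) 3)
    hx
  simp [unknot, euclideanInclusion_apply] at h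

/-- The standard unknot has the empty Gauss diagram (instance-explicit form of the named fact
`unknot_hasGaussDiagram_empty`): the **regular projection of the standard unknot with no
crossing** — diagram `GaussDiagram.empty`, no parameters `θ` (`Fin (2 * 0)` is empty), the plane
curve being the embedded unit circle `t ↦ (cos t, sin t)` (an injective immersion on a period,
missing the north pole), all crossing conditions vacuous. Rolfsen (1976), §1.A, §3.E;
Crowell–Fox (1977), Ch. I, §3. [cite: Rolfsen1976, §3.E] -/
theorem unknot_hasGaussDiagram_empty' : (unknot : Knot).HasGaussDiagram GaussDiagram.empty :=
  ⟨{ diagram := GaussDiagram.empty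
     θ := fun i ↦ Fin.elim0 i
     strictMono := fun i ↦ Fin.elim0 i
     lt_add_two_pi := fun i ↦ Fin.elim0 i
     northPole_notMem := northPole_notMem_range_unknot
     deriv_ne_zero := deriv_planeCurve_unknot_ne_zero
     double := fun i ↦ Fin.elim0 i
     eq_or_crossing := fun _ _ h ↦ Or.inl (exists_eq_add_of_planeCurve_unknot_eq h)
     heightCurve_lt := fun i ↦ Fin.elim0 i
     sign_eq := fun i ↦ Fin.elim0 i }, rfl⟩

end Unknot

/-- Discharge of the named fact `unknot_hasGaussDiagram_empty`: **the standard unknot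
`t ↦ (cos t, sin t, 0, 0)` is in regular position with no crossing, so it has the empty Gauss
diagram** (`unknot_hasGaussDiagram_empty'`: its plane curve is the unit circle, an injective
immersion on a period). Rolfsen (1976), §1.A (the unknot), §3.E (regular projections);
Crowell–Fox (1977), Ch. I, §3, pp. 6–7. [cite: Rolfsen1976, §3.E] -/
theorem unknot_hasGaussDiagram_empty_holds : unknot_hasGaussDiagram_empty := by
  intro _
  exact unknot_hasGaussDiagram_empty'

end Literature.Topology.FourManifolds
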